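import Literature.AlgebraicGeometry.Resolution.SmoothDescentFlat
import Mathlib.AlgebraicGeometry.Morphisms.Smooth
import Mathlib.AlgebraicGeometry.Morphisms.Flat
import Mathlib.AlgebraicGeometry.Morphisms.FinitePresentation
import Mathlib.AlgebraicGeometry.Morphisms.Affine
import HarnessLib

/-!
# Smoothness descends along an AFFINE faithfully flat morphism of finite presentation on the source (EGA IV₄ 17.7.7 / Stacks 05B5),
# in every characteristic

Layer `Literature/AlgebraicGeometry/Morphisms`, namespace `Literature.AlgebraicGeometry.Morphisms`.  Cell `hodgecm-mathlib` (D-0151),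
P6 «MOD programme», deal (s2-D) organ (P3) (LEAD F0P6-plan (g2) M-25 / M-28; prover seat B-p04 (g39)).  THEOREMS ONLY (no definition, no
instance, no named fact, no `sorry`).

★ `Morphisms.smooth_of_flat_surjective_of_smooth_comp` (`SmoothOfFlatSurjectiveSmoothSource.lean`) proves «`ψ : A → Q` flat surjective,
`ψ ≫ g` smooth ⇒ `g` smooth» through the REGULAR-fibre criterion and therefore asks the residue fields of the base to be PERFECT.  This
file removes that hypothesis when `ψ` is AFFINE and locally of finite presentation (the case of a finite étale cover, e.g. the quotient map
`A → A/K` of an abelian scheme by a free finite group of translations): the ring statement is ★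
`Resolution.smooth_of_faithfullyFlat_of_finitePresentation` (Stacks 05B5 with `q` of finite presentation, through 05AX «smoothness
descends along faithfully flat maps over a field» and the SMOOTH-fibre criterion Mathlib `Algebra.Smooth.of_formallySmooth_fiber`), and the
scheme statement is glued from it by Zariski locality of `Smooth` on target and source (Mathlib `HasRingHomProperty`) and Mathlib
`flat_and_surjective_iff_faithfullyFlat_of_isAffine`.
* `smooth_of_affine_flat_surjective_of_smooth_comp_of_isAffine` — the case `Q`, `S` affine;
* **`smooth_of_affine_flat_surjective_of_smooth_comp`** — for `ψ : A ⟶ Q` affine, flat, surjective and locally of finite presentation,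
  `g : Q ⟶ S` locally of finite presentation and `ψ ≫ g` smooth: `g` is smooth.
HC_CM is proved only modulo the 2 remaining named inputs (hLiu418, h413); this file asserts nothing about HC and is count-neutral.

## References
* [Grothendieck1967] A. Grothendieck, *EGA IV₄* (1967), Prop. 17.7.7.
* [StacksProject] The Stacks Project, Tag 05B5, Tag 05AX, Tag 02JZ, Tag 01V8.
-/

set_option autoImplicit false

noncomputable section

universe u

open CategoryTheory CategoryTheory.Limits AlgebraicGeometry TopologicalSpace

namespace Literature.AlgebraicGeometry.Morphisms

open Literature.AlgebraicGeometry.Resolution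

/-- **EGA IV₄ 17.7.7, affine case.**  `A → Q → S` with `Q`, `S` affine, `ψ : A → Q` affine (so `A` is affine), flat, surjective and
locally of finite presentation, `g : Q → S` locally of finite presentation, `ψ ≫ g` smooth ⇒ `g` smooth: on global sections
`Γ(S) → Γ(Q) → Γ(A)` is faithfully flat of finite presentation on the right (Mathlib `flat_and_surjective_iff_faithfullyFlat_of_isAffine`)
with smooth composite, so ★ `smooth_of_faithfullyFlat_of_finitePresentation` (Stacks 05B5) applies. [cite: StacksProject, Tag 05B5]
[cite: Grothendieck1967, Prop. 17.7.7] -/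
theorem smooth_of_affine_flat_surjective_of_smooth_comp_of_isAffine {A Q S : Scheme.{u}} (ψ : A ⟶ Q) (g : Q ⟶ S)
    [IsAffine Q] [IsAffine S] [IsAffineHom ψ] [Flat ψ] [Surjective ψ] [LocallyOfFinitePresentation ψ]
    [LocallyOfFinitePresentation g] [Smooth (ψ ≫ g)] : Smooth g := by
  haveI : IsAffine A := isAffine_of_isAffineHom ψ
  have hff : ψ.appTop.hom.FaithfullyFlat :=
    (Flat.flat_and_surjective_iff_faithfullyFlat_of_isAffine ψ).mp ⟨inferInstance, inferInstance⟩
  have hψfp : ψ.appTop.hom.FinitePresentation :=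
    (HasRingHomProperty.iff_of_isAffine (P := @LocallyOfFinitePresentation)).mp inferInstance
  have hgfp : g.appTop.hom.FinitePresentation :=
    (HasRingHomProperty.iff_of_isAffine (P := @LocallyOfFinitePresentation)).mp inferInstance
  have hsm : (ψ ≫ g).appTop.hom.Smooth := (HasRingHomProperty.iff_of_isAffine (P := @Smooth)).mp inferInstance
  rw [Scheme.Hom.comp_appTop] at hsm
  rw [HasRingHomProperty.iff_of_isAffine (P := @Smooth)]
  algebraize [g.appTop.hom, ψ.appTop.hom, (g.appTop ≫ ψ.appTop).hom]
  haveI : IsScalarTower Γ(S, ⊤) Γ(Q, ⊤) Γ(A, ⊤) := IsScalarTower.of_algebraMap_eq' rfl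
  exact smooth_of_faithfullyFlat_of_finitePresentation Γ(S, ⊤) Γ(Q, ⊤) Γ(A, ⊤)

/-- **EGA IV₄ 17.7.7 for an affine cover of the source, any characteristic.**  For `ψ : A ⟶ Q` AFFINE, flat, surjective and locally
of finite presentation, `g : Q ⟶ S` locally of finite presentation and `ψ ≫ g` smooth, `g` is smooth — Zariski-locally on `S`
(Mathlib `IsZariskiLocalAtTarget`, `morphismRestrict_comp`) and on `Q` (`IsZariskiLocalAtSource`, `morphismRestrict_ι`) this is the affine
case `smooth_of_affine_flat_surjective_of_smooth_comp_of_isAffine`. [cite: Grothendieck1967, Prop. 17.7.7] [cite: StacksProject, Tag 05B5] -/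
theorem smooth_of_affine_flat_surjective_of_smooth_comp {A Q S : Scheme.{u}} (ψ : A ⟶ Q) (g : Q ⟶ S) (f : A ⟶ S)
    (hf : ψ ≫ g = f) [IsAffineHom ψ] [Flat ψ] [Surjective ψ] [LocallyOfFinitePresentation ψ] [LocallyOfFinitePresentation g]
    [Smooth f] : Smooth g := by
  subst hf
  -- reduce to `S` affine
  rw [IsZariskiLocalAtTarget.iff_of_iSup_eq_top (P := @Smooth) _ (iSup_affineOpens_eq_top S)]
  intro U
  haveI : IsAffineHom (ψ ∣_ g ⁻¹ᵁ U.1) := IsZariskiLocalAtTarget.restrict ‹IsAffineHom ψ› _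
  haveI : Flat (ψ ∣_ g ⁻¹ᵁ U.1) := IsZariskiLocalAtTarget.restrict ‹Flat ψ› _
  haveI : Surjective (ψ ∣_ g ⁻¹ᵁ U.1) := IsZariskiLocalAtTarget.restrict ‹Surjective ψ› _
  haveI : LocallyOfFinitePresentation (ψ ∣_ g ⁻¹ᵁ U.1) := IsZariskiLocalAtTarget.restrict ‹LocallyOfFinitePresentation ψ› _
  haveI : LocallyOfFinitePresentation (g ∣_ U.1) := IsZariskiLocalAtTarget.restrict ‹LocallyOfFinitePresentation g› _
  haveI : Smooth ((ψ ∣_ g ⁻¹ᵁ U.1) ≫ (g ∣_ U.1)) := by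
    rw [← morphismRestrict_comp]
    exact IsZariskiLocalAtTarget.restrict ‹Smooth (ψ ≫ g)› _
  -- reduce to `Q` affine
  rw [IsZariskiLocalAtSource.iff_of_iSup_eq_top (P := @Smooth) _ (iSup_affineOpens_eq_top _)]
  intro V
  haveI : IsAffineHom ((ψ ∣_ g ⁻¹ᵁ U.1) ∣_ V.1) := IsZariskiLocalAtTarget.restrict ‹_› _
  haveI : Flat ((ψ ∣_ g ⁻¹ᵁ U.1) ∣_ V.1) := IsZariskiLocalAtTarget.restrict ‹_› _
  haveI : Surjective ((ψ ∣_ g ⁻¹ᵁ U.1) ∣_ V.1) := IsZariskiLocalAtTarget.restrict ‹_› _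
  haveI : LocallyOfFinitePresentation ((ψ ∣_ g ⁻¹ᵁ U.1) ∣_ V.1) := IsZariskiLocalAtTarget.restrict ‹_› _
  haveI : LocallyOfFinitePresentation (V.1.ι ≫ g ∣_ U.1) := inferInstance
  haveI : Smooth (((ψ ∣_ g ⁻¹ᵁ U.1) ∣_ V.1) ≫ V.1.ι ≫ g ∣_ U.1) := by
    rw [← Category.assoc, morphismRestrict_ι, Category.assoc]
    infer_instance
  exact smooth_of_affine_flat_surjective_of_smooth_comp_of_isAffine ((ψ ∣_ g ⁻¹ᵁ U.1) ∣_ V.1) (V.1.ι ≫ g ∣_ U.1)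

end Literature.AlgebraicGeometry.Morphisms

end
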